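import Literature.Computability.AlgebraicComplexity.KV20UniversalMapInt
import Literature.Computability.Complexity.CodeFPBudgets
import Literature.Computability.Complexity.CodeFPInvFolds
import Literature.Computability.Complexity.CodeFPModArith
import HarnessLib

/-!
# Kumar–Volk 2020/2022, Cor 1.3 (M1 programme, brick (P4)-machine, part 1): the integer universal
# map `Ũ_n` is EVALUATED EXACTLY at an integer point by a polynomial-time string function

Source: M. Kumar, B. L. Volk, *A polynomial degree bound on equations for non-rigid matrices and
small linear circuits*, ACM TOCT 14(2) (2022) art. 6 = arXiv:2003.12938 [KumarVolk2022], §6 = arXiv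
§5, proof of Cor 1.3 (p0009:L1–3): the coefficient vector of the equation `Q_n` is found by
"solving a linear system … [of] dimension `exp(poly(n))` … [by] standard small-space linear
algebra"; in the cell's reduction of record (val-lit, `MEMO-x5g6-KV20-M1-programme.md`, (P4):
`KumarVolk2020.bind₁_uFin_eq_zero_iff_evalSystem`, `KV20Cor13Assembly.lean`) the ENTRIES of that
system are products of integer EVALUATIONS `Ũ_q(z)` of the integer universal map
(`KumarVolk2020.universalMapInt`, `KV20UniversalMapInt.lean`) at grid points `z` of polynomial
bit-size, so the machine side needs: **`z ↦ Ũ(z)` is computable in polynomial time as an exact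
integer** — this file. (Part 2, `KV20EvaluationMatrixFP.lean`: digits, powers, the product.)

* §1 the NUMERIC TWIN of `Ũ`, by plain list arithmetic on `ℕ`-indices: `lagVal` (the Lagrange
  numerator `ũ_a(w) = ∏_{a' < S, a' ≠ a} (w − a')` at the integer nodes `0, …, S−1` of `slotNode`),
  `labVal`/`labTable` (the Shpilka–Volkovich label `Σ_j ũ_a(y_j) x_j` of every slot index `a`),
  `valRound`/`valTable` (the fuelled valuation `ucValN` of the universal circuit, one round = one
  `List.map`), `outVal`, and **`uEvalN n s z j i`** (the value of the entry `(j, i)` at the point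
  whose coordinate `v : Fin s ⊕ Fin s` is `z[finSumFinEquiv v]`);
* §2 **`eval_universalMapInt_eq_uEvalN`** — the twin IS the evaluation: `eval` is a ring
  homomorphism, so it passes through the generic valuation (`map_ucOut`, `map_ucValN` of
  `KV20LinearCircuitEquationsProofs.lean`) and through the index forms `svMapInt_slotNode`,
  `val_slotEquiv_*` of the labels;
* §3 SIZE: `natAbs_valRound_le`, `natAbs_valTable_le` (after `k` rounds every entry is at most
  `((s+1)·A)^k` for a bound `A ≥ 1` on the labels; `A = 2^{|code of the label table|}` by
  `natAbs_getD_le_two_pow`), `length_tabE_valTable_le` (the table's code is `≤ 40·(|code|+j+1)^4`) —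
  the step-indexed invariant of the one genuine loop;
* §4 **`uEvalNFP`**: on any context carrying `1ⁿ`, `1ˢ`, the point `z` (a raw list of integers in
  the difference-pair code `intE`) and indices `j`, `i` as `CodeFP` data, `uEvalN` is `CodeFP` with
  values in `intE` — assembled from the tree's typed combinators (`CodeFP.map`, `intSum`, `filter`,
  `rawGetOr`, and `CodeFP.iterateInv` for the valuation loop with §3 as its size invariant); no
  machine is written by hand.

Plumbing `def`s only (the twins); 0 named facts; census +0. HONEST FRAMING (val-lit): Boolean
plumbing for the machine side of a published CONDITIONAL result's reduction (`kumarVolk2020_cor_1_3`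
stays open by name; its hypothesis `hM1` is untouched here); `VP ≠ VNP` is NOT proved and nothing in
this file bears on it.

## References

* [KumarVolk2022] M. Kumar, B. L. Volk, ACM TOCT 14(2) (2022) art. 6 = arXiv:2003.12938, §4.1
  (the universal circuit and its valuation), Lemma 3.1 (the map `SV`), §6 / arXiv §5 p0009:L1–3
  (proof of Cor 1.3: the linear system is solved in polynomial space).
* [AroraBarak2009] S. Arora, B. Barak, *Computational Complexity: A Modern Approach*, CUP 2009,
  §1.3 (polynomial time: composition and polynomially bounded loops).
-/

noncomputable section

namespace Literature.Computability.AlgebraicComplexity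

namespace KumarVolk2020

namespace UEval

open MvPolynomial Finset Literature.Computability.Complexity
  Literature.Computability.Complexity.ModArith

/-! ### §1. The numeric twin of `Ũ` -/

/-- The number of edge slots `S = sn + s² + n(n+s)` (= `Fintype.card (USlot n s)`, `card_uSlot`).
[cite: KumarVolk2022, §4.1] -/
def nS (n s : ℕ) : ℕ := s * n + (s * s + n * (n + s))

/-- The Lagrange numerator of the node `a` among the integer nodes `0, …, S − 1`, at `w`:
`ũ_a(w) = ∏_{a' < S, a' ≠ a} (w − a')`. [cite: KumarVolk2022, Lemma 3.1 (proof)] -/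
def lagVal (S a : ℕ) (w : ℤ) : ℤ :=
  (((List.range S).filter fun a' => a' ≠ a).map fun a' : ℕ => w - (a' : ℤ)).prod

/-- The label of the slot of index `a` at the point `z` (coordinates `x_j = z[j]`, `y_j = z[s+j]`):
`Σ_{j < s} ũ_a(y_j) · x_j`. [cite: KumarVolk2022, Lemma 3.1 (proof), §4.1] -/
def labVal (S s a : ℕ) (z : List ℤ) : ℤ :=
  ((List.range s).map fun j => lagVal S a (z.getD (s + j) 0) * z.getD j 0).sum

/-- The table of all slot labels at `z`, indexed by the slot index. [cite: KumarVolk2022, §4.1] -/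
def labTable (n s : ℕ) (z : List ℤ) : List ℤ :=
  (List.range (nS n s)).map fun a => labVal (nS n s) s a z

/-- One round of the valuation of the universal circuit with numeric labels `lab`: row `t`, column
`i` of the new table is `lab[X_i → t] + Σ_{t' < t} lab[t' → t] · old[t'][i]` (slot indices
`i + n t` and `sn + (t' + s t)`, `val_slotEquiv_in/_gate`). [cite: KumarVolk2022, §4.1] -/
def valRound (n s : ℕ) (lab : List ℤ) (old : List (List ℤ)) : List (List ℤ) :=
  (List.range s).map fun t => (List.range n).map fun i =>
    lab.getD (i + n * t) 0 +
      ((List.range t).map fun t' => lab.getD (s * n + (t' + s * t)) 0 * (old.getD t' []).getD i 0).sum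

/-- The valuation table after `k` rounds (twin of `ucValN · k`; the empty table reads `0`).
[cite: KumarVolk2022, §4.1] -/
def valTable (n s : ℕ) (lab : List ℤ) (k : ℕ) : List (List ℤ) := (valRound n s lab)^[k] []

/-- The output entry `(j, i)`: `lab[X_i → out_j] + Σ_{t < s} lab[t → out_j] · val[t][i]` (slot indices
`sn + s² + (i + (n+s) j)` and `sn + s² + ((n+t) + (n+s) j)`, `val_slotEquiv_outIn/_outGate`).
[cite: KumarVolk2022, §4.1] -/
def outVal (n s : ℕ) (lab : List ℤ) (val : List (List ℤ)) (j i : ℕ) : ℤ :=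
  lab.getD (s * n + (s * s + (i + (n + s) * j))) 0 +
    ((List.range s).map fun t =>
      lab.getD (s * n + (s * s + ((n + t) + (n + s) * j))) 0 * (val.getD t []).getD i 0).sum

/-- **The numeric twin of the integer universal map**: the value of the entry `(j, i)` of `Ũ` for
size-`s` circuits on `n × n` matrices at the integer point `z` (a list of `2s` coordinates).
[cite: KumarVolk2022, §4.1] -/
def uEvalN (n s : ℕ) (z : List ℤ) (j i : ℕ) : ℤ :=
  outVal n s (labTable n s z) (valTable n s (labTable n s z) s) j i

/-- The point of `ℤ^{Fin s ⊕ Fin s}` read off a coordinate list: `v ↦ z[finSumFinEquiv v]`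
(`x_j = z[j]`, `y_j = z[s + j]`). [cite: KumarVolk2022, §4.1] -/
def pt (s : ℕ) (z : List ℤ) : Fin s ⊕ Fin s → ℤ := fun v => z.getD (finSumFinEquiv v : ℕ) 0

/-! ### §2. The twin is the evaluation -/

section Semantics

variable (n s : ℕ) (z : List ℤ)

/-- `pt` on an `x`-coordinate (`x = inl`, the first `s` entries). [cite: KumarVolk2022, §4.1] -/
@[simp] theorem pt_inl (j : Fin s) : pt s z (Sum.inl j) = z.getD j 0 := by
  unfold pt
  rw [finSumFinEquiv_apply_left]
  rfl

/-- `pt` on a `y`-coordinate (`y = inr`, the last `s` entries). [cite: KumarVolk2022, §4.1] -/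
@[simp] theorem pt_inr (j : Fin s) : pt s z (Sum.inr j) = z.getD (s + j) 0 := by
  unfold pt
  rw [finSumFinEquiv_apply_right]
  rfl

/-- Reading a mapped range. [folklore] -/
private theorem getD_map_range {α : Type*} (f : ℕ → α) {N a : ℕ} (h : a < N) (d : α) :
    ((List.range N).map f).getD a d = f a := by
  rw [List.getD_eq_getElem?_getD, List.getElem?_map, List.getElem?_range h]
  rfl

/-- `nS = |USlot n s|`. [cite: KumarVolk2022, §4.1] -/
theorem nS_eq_card : nS n s = Fintype.card (USlot n s) := by
  rw [card_uSlot]; rfl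

/-- The numeric Lagrange numerator is the evaluation of the index form of `lagrangeNumerator`.
[cite: KumarVolk2022, Lemma 3.1 (proof)] -/
theorem prod_erase_range_eq_lagVal (S a : ℕ) (w : ℤ) :
    ∏ a' ∈ (range S).erase a, (w - (a' : ℤ)) = lagVal S a w := by
  unfold lagVal
  rw [← List.prod_toFinset _ ((List.nodup_range).filter _), List.toFinset_filter,
    List.toFinset_range]
  simp only [decide_eq_true_eq, Finset.filter_ne']

/-- **The labels**: at the point `pt s z` the Shpilka–Volkovich label of the slot `e` evaluates to
the table entry at the slot's index. [cite: KumarVolk2022, Lemma 3.1 (proof), §4.1] -/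
theorem eval_svMapInt_slotNode (e : USlot n s) :
    eval (pt s z) (svMapInt (slotNode n s) s e) = labVal (nS n s) s (slotEquiv n s e) z := by
  rw [svMapInt_slotNode, map_sum]
  unfold labVal
  rw [sum_map_range, ← Fin.sum_univ_eq_sum_range
    (fun j => lagVal (nS n s) (slotEquiv n s e) (z.getD (s + j) 0) * z.getD j 0) s]
  refine Finset.sum_congr rfl fun j _ => ?_
  rw [map_mul, map_prod, eval_X, pt_inl]
  congr 1
  rw [← prod_erase_range_eq_lagVal]
  refine Finset.prod_congr rfl fun a' _ => ?_
  rw [map_sub, eval_X, eval_C, pt_inr]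

/-- The label function of the valuation, read off the table. [cite: KumarVolk2022, §4.1] -/
theorem eval_svMapInt_eq_getD (e : USlot n s) :
    eval (pt s z) (svMapInt (slotNode n s) s e) = (labTable n s z).getD (slotEquiv n s e : ℕ) 0 := by
  rw [eval_svMapInt_slotNode, labTable, getD_map_range _ (by rw [nS]; exact (slotEquiv n s e).isLt)]

/-- A `Fin s`-sum with the guard `t' < t` is the sum over `range t` (`t ≤ s`). [folklore] -/
private theorem sum_ite_lt_eq_sum_range {M : Type*} [AddCommMonoid M] (t : Fin s) (g : ℕ → M) :
    (∑ t' : Fin s, if t' < t then g t' else 0) = ∑ t' ∈ range t, g t' := by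
  have h : ∀ t' : Fin s, (if t' < t then g t' else 0) =
      (fun m : ℕ => if m < (t : ℕ) then g m else 0) t' := fun _ => rfl
  rw [Finset.sum_congr rfl fun t' _ => h t',
    Fin.sum_univ_eq_sum_range (fun m => if m < (t : ℕ) then g m else 0) s, ← Finset.sum_filter]
  congr 1
  ext t'
  simp only [Finset.mem_filter, Finset.mem_range]
  omega

/-- **The valuation**: with labels read off `lab`, the generic fuelled valuation `ucValN` is the
table `valTable`. [cite: KumarVolk2022, §4.1] -/
theorem ucValN_eq_valTable (lab : List ℤ) :
    ∀ (k : ℕ) (t : Fin s) (i : Fin n),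
      ucValN (fun e => lab.getD (slotEquiv n s e : ℕ) 0) k t i =
        ((valTable n s lab k).getD t []).getD i 0 := by
  intro k
  induction k with
  | zero => intro t i; simp [ucValN, valTable]
  | succ k ih =>
    intro t i
    change lab.getD (slotEquiv n s (Sum.inl (t, i)) : ℕ) 0 + ∑ t' : Fin s,
        (if t' < t then lab.getD (slotEquiv n s (Sum.inr (Sum.inl (t, t'))) : ℕ) 0 *
          ucValN (fun e => lab.getD (slotEquiv n s e : ℕ) 0) k t' i else 0) = _
    rw [valTable, Function.iterate_succ_apply', ← valTable, valRound, getD_map_range _ t.isLt,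
      getD_map_range _ i.isLt, val_slotEquiv_in, sum_map_range]
    congr 1
    have h : ∀ t' : Fin s, (if t' < t then lab.getD (slotEquiv n s (Sum.inr (Sum.inl (t, t'))) : ℕ) 0 *
          ucValN (fun e => lab.getD (slotEquiv n s e : ℕ) 0) k t' i else 0) =
        (if t' < t then lab.getD (s * n + (t' + s * t)) 0 *
          ((valTable n s lab k).getD t' []).getD i 0 else 0) := by
      intro t'
      simp only [val_slotEquiv_gate, ih]
    rw [Finset.sum_congr rfl fun t' _ => h t']
    exact sum_ite_lt_eq_sum_range s t (fun t' => lab.getD (s * n + (t' + s * t)) 0 *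
      ((valTable n s lab k).getD t' []).getD i 0)

/-- **The output**: with labels read off `lab`, `ucOut` is `outVal`. [cite: KumarVolk2022, §4.1] -/
theorem ucOut_eq_outVal (lab : List ℤ) (j i : Fin n) :
    ucOut (fun e => lab.getD (slotEquiv n s e : ℕ) 0) j i =
      outVal n s lab (valTable n s lab s) j i := by
  unfold ucOut outVal
  simp only [val_slotEquiv_outIn, val_slotEquiv_outGate]
  rw [sum_map_range, ← Fin.sum_univ_eq_sum_range (fun t =>
    lab.getD (s * n + (s * s + ((n + t) + (n + s) * j))) 0 * ((valTable n s lab s).getD t []).getD i 0) s]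
  congr 1
  refine Finset.sum_congr rfl fun t _ => ?_
  rw [ucVal, ucValN_eq_valTable]

/-- ★ **The numeric twin IS the evaluation of the integer universal map**:
`Ũ_{(j,i)}(pt s z) = uEvalN n s z j i`. [cite: KumarVolk2022, §4.1] -/
theorem eval_universalMapInt_eq_uEvalN (j i : Fin n) :
    eval (pt s z) (universalMapInt n s (j, i)) = uEvalN n s z j i := by
  rw [universalMapInt, map_ucOut (eval (pt s z))]
  have h : (fun e => eval (pt s z) (svMapInt (slotNode n s) s e)) =
      fun e => (labTable n s z).getD (slotEquiv n s e : ℕ) 0 := funext (eval_svMapInt_eq_getD n s z)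
  rw [h, ucOut_eq_outVal]
  rfl

end Semantics

/-! ### §3. Sizes: the shape of the valuation table and the growth of its entries -/

section Sizes

variable (n s : ℕ) (lab : List ℤ)

/-- One round produces `s` rows. [cite: KumarVolk2022, §4.1] -/
theorem length_valRound (old : List (List ℤ)) : (valRound n s lab old).length = s := by
  simp [valRound]

/-- Every row of a round has `n` entries. [cite: KumarVolk2022, §4.1] -/
theorem length_of_mem_valRound {old : List (List ℤ)} {row : List ℤ} (h : row ∈ valRound n s lab old) :
    row.length = n := by
  unfold valRound at h
  obtain ⟨t, -, rfl⟩ := List.mem_map.1 h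
  simp

/-- Reading off the end of a list gives the default. [folklore] -/
private theorem getD_of_le {α : Type*} {l : List α} {i : ℕ} (h : l.length ≤ i) (d : α) : l.getD i d = d := by
  rw [List.getD_eq_getElem?_getD, List.getElem?_eq_none h]
  rfl

/-- `|Σ l| ≤ Σ |·|` (re-export shape). [folklore] -/
private theorem natAbs_sum_map_le {α : Type*} (l : List α) (f : α → ℤ) {B : ℕ}
    (h : ∀ a ∈ l, (f a).natAbs ≤ B) : ((l.map f).sum).natAbs ≤ l.length * B := by
  induction l with
  | nil => simp
  | cons a l ih =>
    rw [List.map_cons, List.sum_cons, List.length_cons]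
    have h1 := h a (by simp)
    have h2 := ih fun b hb => h b (by simp [hb])
    calc (f a + (l.map f).sum).natAbs ≤ (f a).natAbs + ((l.map f).sum).natAbs := Int.natAbs_add_le _ _
      _ ≤ B + l.length * B := Nat.add_le_add h1 h2
      _ = (l.length + 1) * B := by ring

/-- **Growth of one round**: if the labels are bounded by `A` and the old entries by `B ≥ 1`, the new
entries are bounded by `(s + 1) · A · B`. [cite: KumarVolk2022, §4.1] -/
theorem natAbs_valRound_le {A B : ℕ} (hA : ∀ a, (lab.getD a 0).natAbs ≤ A) (hB : 1 ≤ B)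
    {old : List (List ℤ)} (hold : ∀ t i, ((old.getD t []).getD i 0).natAbs ≤ B) (t i : ℕ) :
    (((valRound n s lab old).getD t []).getD i 0).natAbs ≤ (s + 1) * A * B := by
  by_cases ht : t < s
  · by_cases hi : i < n
    · rw [valRound, getD_map_range _ ht, getD_map_range _ hi]
      have h1 : (lab.getD (i + n * t) 0).natAbs ≤ A * B :=
        (hA _).trans (Nat.le_mul_of_pos_right A hB)
      have h2 : (((List.range t).map fun t' =>
          lab.getD (s * n + (t' + s * t)) 0 * (old.getD t' []).getD i 0).sum).natAbs ≤ t * (A * B) := by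
        have := natAbs_sum_map_le (List.range t)
          (fun t' => lab.getD (s * n + (t' + s * t)) 0 * (old.getD t' []).getD i 0) (B := A * B)
          (fun t' _ => by rw [Int.natAbs_mul]; exact Nat.mul_le_mul (hA _) (hold _ _))
        simpa using this
      calc _ ≤ (lab.getD (i + n * t) 0).natAbs + (((List.range t).map fun t' =>
              lab.getD (s * n + (t' + s * t)) 0 * (old.getD t' []).getD i 0).sum).natAbs :=
            Int.natAbs_add_le _ _
        _ ≤ A * B + t * (A * B) := Nat.add_le_add h1 h2
        _ ≤ A * B + s * (A * B) := by gcongr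
        _ = (s + 1) * A * B := by ring
    · rw [valRound, getD_map_range _ ht]
      have h0 : ((List.range n).map fun i => lab.getD (i + n * t) 0 +
          ((List.range t).map fun t' => lab.getD (s * n + (t' + s * t)) 0 * (old.getD t' []).getD i 0).sum).getD
            i 0 = 0 := getD_of_le (by simp; omega) _
      rw [h0]
      simp
  · have h0 : (valRound n s lab old).getD t [] = [] := getD_of_le (by rw [length_valRound]; omega) _
    rw [h0]
    simp

/-- `valTable (k+1) = valRound (valTable k)`. [cite: KumarVolk2022, §4.1] -/
theorem valTable_succ (k : ℕ) : valTable n s lab (k + 1) = valRound n s lab (valTable n s lab k) := by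
  rw [valTable, Function.iterate_succ_apply', ← valTable]

/-- **Growth of the valuation table**: with labels bounded by `A ≥ 1`, after `k` rounds every entry
is bounded by `((s + 1) · A)^k`. [cite: KumarVolk2022, §4.1] -/
theorem natAbs_valTable_le {A : ℕ} (hA1 : 1 ≤ A) (hA : ∀ a, (lab.getD a 0).natAbs ≤ A) :
    ∀ (k t i : ℕ), (((valTable n s lab k).getD t []).getD i 0).natAbs ≤ ((s + 1) * A) ^ k := by
  intro k
  induction k with
  | zero => intro t i; simp [valTable]
  | succ k ih =>
    intro t i
    rw [valTable_succ]
    refine (natAbs_valRound_le n s lab hA (Nat.one_le_pow _ _ (Nat.mul_pos (Nat.succ_pos s) hA1))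
      ih t i).trans (le_of_eq ?_)
    rw [pow_succ, mul_comm]

/-- The table after `k ≥ 1` rounds has `s` rows … [cite: KumarVolk2022, §4.1] -/
theorem length_valTable_le (k : ℕ) : (valTable n s lab k).length ≤ s := by
  cases k with
  | zero => simp [valTable]
  | succ k => rw [valTable_succ, length_valRound]

/-- … each of `n` entries. [cite: KumarVolk2022, §4.1] -/
theorem length_of_mem_valTable {k : ℕ} {row : List ℤ} (h : row ∈ valTable n s lab k) :
    row.length ≤ n := by
  cases k with
  | zero => simp [valTable] at h
  | succ k => rw [valTable_succ] at h; exact (length_of_mem_valRound n s lab h).le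

open Literature.Computability.Complexity.CodeFP in
/-- **The labels are bounded by `2^{|code of the label table|}`.** [folklore] -/
private theorem natAbs_getD_le_two_pow (a : ℕ) : (lab.getD a 0).natAbs ≤ 2 ^ (rawE intE lab).length := by
  by_cases h : a < lab.length
  · have hmem : lab.getD a 0 ∈ lab := by
      rw [List.getD_eq_getElem?_getD, List.getElem?_eq_getElem h]
      exact List.getElem_mem h
    refine (Nat.lt_size_self _).le.trans (Nat.pow_le_pow_right (by norm_num) ?_)
    refine (size_natAbs_le_length_intE _).trans ?_
    have := length_item_le_length_rawE intE hmem
    omega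
  · rw [getD_of_le (not_lt.1 h)]
    simp

end Sizes

/-! ### §4. The twin on codes -/

section Codes

open _root_.Computability Literature.Computability.Complexity.CodeFP Brick

variable {T : Type} {eT : T → List Bool} {nf sf : T → ℕ}

/-- Unary product (the tree's `unitsMul`). [cite: AroraBarak2009, §1.3] -/
private theorem unMulFP {f g : T → ℕ} (hf : CodeFP eT unE f) (hg : CodeFP eT unE g) :
    CodeFP eT unE (fun t => f t * g t) :=
  ((ulength unitE).comp (unitsMul.comp ((replicateUnit.comp hf).pair (replicateUnit.comp hg)))).congr
    fun p => by simp

/-- A unary numeral, read in binary. [folklore] -/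
private theorem natOfUn' {f : T → ℕ} (h : CodeFP eT unE f) : CodeFP eT natE f :=
  (natOfUn.comp h).congr fun _ => rfl

/-- `S = nS n s` in unary. [cite: AroraBarak2009, §1.3] -/
private theorem nSUFP (hn : CodeFP eT unE nf) (hs : CodeFP eT unE sf) :
    CodeFP eT unE (fun t => nS (nf t) (sf t)) :=
  (unAdd.comp ((unMulFP hs hn).pair (unAdd.comp ((unMulFP hs hs).pair
    (unMulFP hn (unAdd.comp (hn.pair hs))))))).congr fun _ => rfl

/-- `|∏ l| = ∏ |·|` for integer lists. [folklore] -/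
private theorem natAbs_prod' (l : List ℤ) : l.prod.natAbs = (l.map Int.natAbs).prod := by
  induction l with
  | nil => simp
  | cons a l ih => rw [List.prod_cons, List.map_cons, List.prod_cons, Int.natAbs_mul, ih]

/-- `size (∏ l) ≤ Σ size + 1`. [folklore] -/
private theorem size_prod_le' (l : List ℕ) : Nat.size l.prod ≤ (l.map Nat.size).sum + 1 := by
  induction l with
  | nil => simp
  | cons a l ih =>
    rw [List.prod_cons, List.map_cons, List.sum_cons]
    exact (size_mul_le _ _).trans (by omega)

/-- The multiplying fold. [folklore] -/
private theorem foldl_mul_eq_prod_int' (l : List ℤ) (acc : ℤ) :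
    l.foldl (fun acc a => acc * a) acc = acc * l.prod := by
  induction l generalizing acc with
  | nil => simp
  | cons a l ih => rw [List.foldl_cons, ih, List.prod_cons]; ring

/-- **Products of raw lists of integers** (same statement and proof as the tree's
`SumcheckMAReferee.intProd`, kept private here to spare the import). [cite: AroraBarak2009, §1.3] -/
private theorem intProd' : CodeFP (rawE intE) intE List.prod := by
  have hstep : CodeFP (pairE intE intE) intE (fun t => t.2 * t.1) := (intMul.comp ((snd _ _).pair (fst _ _)) :)
  have h := foldl₀ (step := fun (a : ℤ) acc => acc * a) (b₀ := 1) hstep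
    (3 * Polynomial.X + 6) (fun l₁ l₂ => by
      rw [foldl_mul_eq_prod_int', one_mul]
      simp only [Polynomial.eval_add, Polynomial.eval_mul, Polynomial.eval_X, Polynomial.eval_ofNat]
      set L := (rawE intE (l₁ ++ l₂)).length
      have hsum : ((l₁.map Int.natAbs).map Nat.size).sum ≤ L := by
        rw [List.map_map]
        have h1 : ((l₁ ++ l₂).map fun a => 2 * (intE a).length + 2).sum = L :=
          (length_rawE intE (l₁ ++ l₂)).symm
        have h2 : (l₁.map (Nat.size ∘ Int.natAbs)).sum ≤ (l₁.map fun a => 2 * (intE a).length + 2).sum :=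
          List.sum_le_sum fun z _ => by
            have := size_natAbs_le_length_intE z
            simp only [Function.comp_apply]; omega
        have h3 : (l₁.map fun a => 2 * (intE a).length + 2).sum ≤
            ((l₁ ++ l₂).map fun a => 2 * (intE a).length + 2).sum := by
          rw [List.map_append, List.sum_append]; omega
        omega
      have h1 := length_dpEnc_le l₁.prod
      have h2 : Nat.size l₁.prod.natAbs ≤ L + 1 := by
        rw [natAbs_prod']
        exact (size_prod_le' _).trans (by omega)
      change (dpEnc l₁.prod).length ≤ _
      omega)
  exact h.congr fun l => by rw [foldl_mul_eq_prod_int', one_mul]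

/-- **The Lagrange numerator on codes**: `(S, a, w) ↦ ũ_a(w)` (a filtered range, one product).
[cite: KumarVolk2022, Lemma 3.1 (proof)] [cite: AroraBarak2009, §1.3] -/
theorem lagValFP {Sf af : T → ℕ} {wf : T → ℤ} (hS : CodeFP eT unE Sf) (ha : CodeFP eT natE af)
    (hw : CodeFP eT intE wf) : CodeFP eT intE (fun t => lagVal (Sf t) (af t) (wf t)) := by
  have qp : CodeFP (pairE eT natE) bitE (fun q => decide (q.2 ≠ af q.1)) :=
    (natEq.comp ((snd _ _).pair (ha.comp (fst _ _)))).not.congr fun q => by simp only [ne_eq, decide_not]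
  have hfil : CodeFP eT (rawE natE) (fun t => (List.range (Sf t)).filter fun a' => a' ≠ af t) :=
    ((filter qp).comp ((CodeFP.id eT).pair (urange.comp hS))).congr fun _ => rfl
  have qg : CodeFP (pairE eT natE) intE (fun q => wf q.1 - (q.2 : ℤ)) :=
    (intSub.comp ((hw.comp (fst _ _)).pair (intOfNat.comp (snd _ _))) :)
  have hmap : CodeFP eT (rawE intE)
      (fun t => ((List.range (Sf t)).filter fun a' => a' ≠ af t).map fun a' : ℕ => wf t - (a' : ℤ)) :=
    ((CodeFP.map qg).comp ((CodeFP.id eT).pair hfil) :)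
  exact (intProd'.comp hmap).congr fun _ => rfl

/-- **A slot label on codes**: `(S, s, a, z) ↦ Σ_{j<s} ũ_a(z[s+j]) · z[j]`.
[cite: KumarVolk2022, Lemma 3.1 (proof), §4.1] [cite: AroraBarak2009, §1.3] -/
theorem labValFP {Sf af : T → ℕ} {zf : T → List ℤ} (hS : CodeFP eT unE Sf) (hs : CodeFP eT unE sf)
    (ha : CodeFP eT natE af) (hz : CodeFP eT (rawE intE) zf) :
    CodeFP eT intE (fun t => labVal (Sf t) (sf t) (af t) (zf t)) := by
  have hsN := natOfUn' hs
  have g1 : CodeFP (pairE eT natE) intE (fun q => (zf q.1).getD (sf q.1 + q.2) 0) :=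
    ((rawGetOr intE).comp ((hz.comp (fst _ _)).pair ((natAdd.comp ((hsN.comp (fst _ _)).pair (snd _ _))).pair
      (const _ (0 : ℤ)))) :)
  have g0 : CodeFP (pairE eT natE) intE (fun q => (zf q.1).getD q.2 0) :=
    ((rawGetOr intE).comp ((hz.comp (fst _ _)).pair ((snd _ _).pair (const _ (0 : ℤ)))) :)
  have hlag : CodeFP (pairE eT natE) intE (fun q => lagVal (Sf q.1) (af q.1) ((zf q.1).getD (sf q.1 + q.2) 0)) :=
    (lagValFP (hS.comp (fst _ _)) (ha.comp (fst _ _)) g1 :)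
  have qitem : CodeFP (pairE eT natE) intE
      (fun q => lagVal (Sf q.1) (af q.1) ((zf q.1).getD (sf q.1 + q.2) 0) * (zf q.1).getD q.2 0) :=
    (intMul.comp (hlag.pair g0) :)
  exact (intSum.comp ((CodeFP.map qitem).comp ((CodeFP.id eT).pair (urange.comp hs)))).congr fun _ => rfl

/-- **The label table on codes.** [cite: KumarVolk2022, §4.1] [cite: AroraBarak2009, §1.3] -/
theorem labTableFP {zf : T → List ℤ} (hn : CodeFP eT unE nf) (hs : CodeFP eT unE sf)
    (hz : CodeFP eT (rawE intE) zf) :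
    CodeFP eT (rawE intE) (fun t => labTable (nf t) (sf t) (zf t)) := by
  have hS := nSUFP hn hs
  have item : CodeFP (pairE eT natE) intE (fun q => labVal (nS (nf q.1) (sf q.1)) (sf q.1) q.2 (zf q.1)) :=
    (labValFP (hS.comp (fst _ _)) (hs.comp (fst _ _)) (snd _ _) (hz.comp (fst _ _)) :)
  exact ((CodeFP.map item).comp ((CodeFP.id eT).pair (urange.comp hS))).congr fun _ => rfl

/-- The code of the loop context `(n, s, lab)`: `1ⁿ`, `1ˢ`, the label table. [folklore] -/
abbrev ctxE : ℕ × ℕ × List ℤ → List Bool := pairE unE (pairE unE (rawE intE))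

/-- The code of a valuation table: a raw list of raw integer rows. [folklore] -/
abbrev tabE : List (List ℤ) → List Bool := rawE (rawE intE)

/-- **One round of the valuation on codes.** [cite: KumarVolk2022, §4.1] [cite: AroraBarak2009, §1.3] -/
theorem valRoundFP : CodeFP (pairE ctxE tabE) tabE (fun p => valRound p.1.1 p.1.2.1 p.1.2.2 p.2) := by
  -- context `u = ((((c, old), t), i), t')`, `r = (((c, old), t), i)`, `q = ((c, old), t)`
  have un : CodeFP (pairE (pairE (pairE (pairE ctxE tabE) natE) natE) natE) natE (fun u => u.1.1.1.1.1) :=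
    (natOfUn' (fst _ _).fst'.fst'.fst'.fst' :)
  have us : CodeFP (pairE (pairE (pairE (pairE ctxE tabE) natE) natE) natE) natE (fun u => u.1.1.1.1.2.1) :=
    (natOfUn' (fst _ _).fst'.fst'.fst'.snd'.fst' :)
  have ulab : CodeFP (pairE (pairE (pairE (pairE ctxE tabE) natE) natE) natE) (rawE intE)
      (fun u => u.1.1.1.1.2.2) := (fst _ _).fst'.fst'.fst'.snd'.snd'
  have uold : CodeFP (pairE (pairE (pairE (pairE ctxE tabE) natE) natE) natE) tabE (fun u => u.1.1.1.2) :=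
    ((fst _ _).fst'.fst'.snd' :)
  have ut : CodeFP (pairE (pairE (pairE (pairE ctxE tabE) natE) natE) natE) natE (fun u => u.1.1.2) :=
    ((fst _ _).fst'.snd' :)
  have ui : CodeFP (pairE (pairE (pairE (pairE ctxE tabE) natE) natE) natE) natE (fun u => u.1.2) :=
    ((fst _ _).snd' :)
  have ut' : CodeFP (pairE (pairE (pairE (pairE ctxE tabE) natE) natE) natE) natE (fun u => u.2) := snd _ _
  have ulabAt : CodeFP (pairE (pairE (pairE (pairE ctxE tabE) natE) natE) natE) intE
      (fun u => u.1.1.1.1.2.2.getD (u.1.1.1.1.2.1 * u.1.1.1.1.1 + (u.2 + u.1.1.1.1.2.1 * u.1.1.2)) 0) :=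
    ((rawGetOr intE).comp (ulab.pair ((natAdd.comp ((natMul.comp (us.pair un)).pair
      (natAdd.comp (ut'.pair (natMul.comp (us.pair ut)))))).pair (const _ (0 : ℤ)))) :)
  have urow : CodeFP (pairE (pairE (pairE (pairE ctxE tabE) natE) natE) natE) (rawE intE)
      (fun u => u.1.1.1.2.getD u.2 []) :=
    ((rawGetOr (rawE intE)).comp (uold.pair (ut'.pair (const _ ([] : List ℤ)))) :)
  have uoldAt : CodeFP (pairE (pairE (pairE (pairE ctxE tabE) natE) natE) natE) intE
      (fun u => (u.1.1.1.2.getD u.2 []).getD u.1.2 0) :=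
    ((rawGetOr intE).comp (urow.pair (ui.pair (const _ (0 : ℤ)))) :)
  have uitem : CodeFP (pairE (pairE (pairE (pairE ctxE tabE) natE) natE) natE) intE
      (fun u => u.1.1.1.1.2.2.getD (u.1.1.1.1.2.1 * u.1.1.1.1.1 + (u.2 + u.1.1.1.1.2.1 * u.1.1.2)) 0 *
        (u.1.1.1.2.getD u.2 []).getD u.1.2 0) := (intMul.comp (ulabAt.pair uoldAt) :)
  -- level `r = (((c, old), t), i)`
  have rn : CodeFP (pairE (pairE (pairE ctxE tabE) natE) natE) natE (fun r => r.1.1.1.1) :=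
    (natOfUn' (fst _ _).fst'.fst'.fst' :)
  have rlab : CodeFP (pairE (pairE (pairE ctxE tabE) natE) natE) (rawE intE) (fun r => r.1.1.1.2.2) :=
    ((fst _ _).fst'.fst'.snd'.snd' :)
  have rt : CodeFP (pairE (pairE (pairE ctxE tabE) natE) natE) natE (fun r => r.1.2) := (fst _ _).snd'
  have rtU : CodeFP (pairE (pairE (pairE ctxE tabE) natE) natE) unE (fun r => min r.1.2 r.1.1.1.2.1) :=
    (unOfNatMin.comp (((fst _ _).fst'.fst'.snd'.fst').pair rt) :)
  have ri : CodeFP (pairE (pairE (pairE ctxE tabE) natE) natE) natE (fun r => r.2) := snd _ _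
  have rsum : CodeFP (pairE (pairE (pairE ctxE tabE) natE) natE) intE (fun r =>
      ((List.range (min r.1.2 r.1.1.1.2.1)).map fun t' =>
        r.1.1.1.2.2.getD (r.1.1.1.2.1 * r.1.1.1.1 + (t' + r.1.1.1.2.1 * r.1.2)) 0 *
          (r.1.1.2.getD t' []).getD r.2 0).sum) :=
    (intSum.comp ((CodeFP.map uitem).comp ((CodeFP.id _).pair (urange.comp rtU))) :)
  have rhead : CodeFP (pairE (pairE (pairE ctxE tabE) natE) natE) intE
      (fun r => r.1.1.1.2.2.getD (r.2 + r.1.1.1.1 * r.1.2) 0) :=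
    ((rawGetOr intE).comp (rlab.pair ((natAdd.comp (ri.pair (natMul.comp (rn.pair rt)))).pair (const _ (0 : ℤ)))) :)
  have rentry : CodeFP (pairE (pairE (pairE ctxE tabE) natE) natE) intE (fun r =>
      r.1.1.1.2.2.getD (r.2 + r.1.1.1.1 * r.1.2) 0 +
        ((List.range (min r.1.2 r.1.1.1.2.1)).map fun t' =>
          r.1.1.1.2.2.getD (r.1.1.1.2.1 * r.1.1.1.1 + (t' + r.1.1.1.2.1 * r.1.2)) 0 *
            (r.1.1.2.getD t' []).getD r.2 0).sum) := (intAdd.comp (rhead.pair rsum) :)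
  -- level `q = ((c, old), t)`: the row
  have qnU : CodeFP (pairE (pairE ctxE tabE) natE) unE (fun q => q.1.1.1) := (fst _ _).fst'.fst'
  have qrow : CodeFP (pairE (pairE ctxE tabE) natE) (rawE intE) (fun q =>
      (List.range q.1.1.1).map fun i =>
        q.1.1.2.2.getD (i + q.1.1.1 * q.2) 0 +
          ((List.range (min q.2 q.1.1.2.1)).map fun t' =>
            q.1.1.2.2.getD (q.1.1.2.1 * q.1.1.1 + (t' + q.1.1.2.1 * q.2)) 0 *
              (q.1.2.getD t' []).getD i 0).sum) :=
    ((CodeFP.map rentry).comp ((CodeFP.id _).pair (urange.comp qnU)) :)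
  -- level `p = (c, old)`: all rows
  have psU : CodeFP (pairE ctxE tabE) unE (fun p => p.1.2.1) := (fst _ _).snd'.fst'
  have hall := (CodeFP.map qrow).comp ((CodeFP.id _).pair (urange.comp psU))
  refine hall.congr fun p => ?_
  obtain ⟨⟨n', s', lab'⟩, old⟩ := p
  simp only [valRound, id]
  refine List.map_congr_left fun t ht => ?_
  have hts : min t s' = t := min_eq_left (List.mem_range.1 ht).le
  simp only [hts]

/-- Code length of a raw list of integers whose entries have size `≤ β`. [folklore] -/
private theorem length_rawE_intE_le {l : List ℤ} {β : ℕ} (h : ∀ v ∈ l, Nat.size v.natAbs ≤ β) :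
    (rawE intE l).length ≤ l.length * (6 * β + 6) := by
  rw [length_rawE]
  induction l with
  | nil => simp
  | cons a l ih =>
    rw [List.map_cons, List.sum_cons, List.length_cons]
    have h1 : (intE a).length ≤ 3 * β + 2 := (length_dpEnc_le a).trans (by have := h a (by simp); omega)
    have h2 := ih fun v hv => h v (by simp [hv])
    nlinarith

/-- Code length of a table whose `≤ R` rows have `≤ C` entries of size `≤ β`. [folklore] -/
private theorem length_tabE_le {tab : List (List ℤ)} {R C β : ℕ} (hR : tab.length ≤ R)
    (hC : ∀ row ∈ tab, row.length ≤ C) (h : ∀ row ∈ tab, ∀ v ∈ row, Nat.size v.natAbs ≤ β) :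
    (tabE tab).length ≤ R * (2 * (C * (6 * β + 6)) + 2) := by
  have key : (tabE tab).length ≤ tab.length * (2 * (C * (6 * β + 6)) + 2) := by
    change (rawE (rawE intE) tab).length ≤ _
    rw [length_rawE]
    clear hR
    induction tab with
    | nil => simp
    | cons row tab ih =>
      rw [List.map_cons, List.sum_cons, List.length_cons]
      have h1 : (rawE intE row).length ≤ C * (6 * β + 6) :=
        (length_rawE_intE_le (h row (by simp))).trans (Nat.mul_le_mul_right _ (hC row (by simp)))
      have h2 := ih (fun r hr => hC r (by simp [hr])) (fun r hr => h r (by simp [hr]))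
      nlinarith
  exact key.trans (Nat.mul_le_mul_right _ hR)

/-- **The size invariant of the valuation loop**: after `j` rounds the code of the table is
polynomial in `|code (n, s, lab)| + j`. [cite: AroraBarak2009, §1.3] -/
theorem length_tabE_valTable_le (n s : ℕ) (lab : List ℤ) (j : ℕ) :
    (tabE (valTable n s lab j)).length ≤
      (40 * (Polynomial.X + 1) ^ 4 : Polynomial ℕ).eval ((ctxE (n, s, lab)).length + j) := by
  set L := (rawE intE lab).length with hL
  set N := (ctxE (n, s, lab)).length + j with hN
  have hctx : (ctxE (n, s, lab)).length = 2 * n + 2 + (2 * s + 2 + L) := by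
    simp [ctxE, pairE, length_boolPair, length_unE, hL]
  have hnN : n ≤ N := by omega
  have hsN : s ≤ N := by omega
  have hLN : L ≤ N := by omega
  have hjN : j ≤ N := by omega
  set M := N + 1 with hM
  have hM1 : 1 ≤ M := by omega
  have hM2 : 1 ≤ M ^ 2 := Nat.one_le_pow _ _ hM1
  -- entry sizes
  have hA1 : 1 ≤ 2 ^ L := Nat.one_le_two_pow
  have hent : ∀ row ∈ valTable n s lab j, ∀ v ∈ row, Nat.size v.natAbs ≤ 2 * M ^ 2 := by
    intro row hrow v hv
    obtain ⟨t, ht, rfl⟩ := List.mem_iff_getElem.1 hrow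
    obtain ⟨i, hi, rfl⟩ := List.mem_iff_getElem.1 hv
    have hb := natAbs_valTable_le n s lab hA1 (natAbs_getD_le_two_pow lab) j t i
    simp only [List.getD_eq_getElem?_getD, List.getElem?_eq_getElem ht, List.getElem?_eq_getElem hi,
      Option.getD_some] at hb
    refine (size_mono hb).trans ((size_pow_le _ _).trans ?_)
    have h1 : Nat.size ((s + 1) * 2 ^ L) ≤ (s + 1) + (L + 1) :=
      (size_mul_le _ _).trans (Nat.add_le_add (Nat.size_le.2 Nat.lt_two_pow_self) (by rw [Nat.size_pow]))
    have h2 : j * Nat.size ((s + 1) * 2 ^ L) ≤ N * (2 * M) :=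
      Nat.mul_le_mul hjN (h1.trans (by omega))
    have h3 : N * (2 * M) + 1 ≤ 2 * M ^ 2 := by rw [hM]; nlinarith
    omega
  refine (length_tabE_le (length_valTable_le n s lab j) (fun row hrow => length_of_mem_valTable n s lab hrow)
    hent).trans ?_
  simp only [Polynomial.eval_mul, Polynomial.eval_pow, Polynomial.eval_add, Polynomial.eval_X,
    Polynomial.eval_ofNat, Polynomial.eval_one]
  rw [← hM]
  have e1 : 6 * (2 * M ^ 2) + 6 ≤ 18 * M ^ 2 := by omega
  have e2 : n * (6 * (2 * M ^ 2) + 6) ≤ M * (18 * M ^ 2) := Nat.mul_le_mul (by omega) e1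
  have e3 : 2 * (n * (6 * (2 * M ^ 2) + 6)) + 2 ≤ 38 * M ^ 3 := by
    have : M * (18 * M ^ 2) = 18 * M ^ 3 := by ring
    have hM3 : 1 ≤ M ^ 3 := Nat.one_le_pow _ _ hM1
    omega
  have e4 : s * (2 * (n * (6 * (2 * M ^ 2) + 6)) + 2) ≤ M * (38 * M ^ 3) := Nat.mul_le_mul (by omega) e3
  have e5 : M * (38 * M ^ 3) = 38 * M ^ 4 := by ring
  have hM4 : 1 ≤ M ^ 4 := Nat.one_le_pow _ _ hM1
  omega

/-- **The valuation table on codes** (the one genuine loop: `s` rounds of `valRound`, by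
`CodeFP.iterateInv` with the size invariant `length_tabE_valTable_le`).
[cite: KumarVolk2022, §4.1] [cite: AroraBarak2009, §1.3] -/
theorem valTableFP : CodeFP ctxE tabE (fun c => valTable c.1 c.2.1 c.2.2 c.2.1) := by
  have hF : CodeFP (pairE ctxE tabE) tabE (fun p => valRound p.1.1 p.1.2.1 p.1.2.2 p.2) := valRoundFP
  have h := iterateInv (eσ := ctxE) (eβ := tabE) (F := fun c old => valRound c.1 c.2.1 c.2.2 old)
    (init := fun _ => ([] : List (List ℤ))) (k := fun c => c.2.1)
    (fun c j b => b = valTable c.1 c.2.1 c.2.2 j) hF (const _ _) (snd _ _).fst'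
    (fun c => rfl) (fun c j b hb => by rw [hb, valTable_succ])
    (40 * (Polynomial.X + 1) ^ 4) (fun c j b hb => by
      obtain ⟨n', s', lab'⟩ := c
      rw [hb]
      exact length_tabE_valTable_le n' s' lab' j)
  exact h.congr fun c => rfl

/-- **The output entry on codes**: `(n, s, lab, val, j, i) ↦ outVal n s lab val j i`.
[cite: KumarVolk2022, §4.1] [cite: AroraBarak2009, §1.3] -/
theorem outValFP {labf : T → List ℤ} {valf : T → List (List ℤ)} {jf i'f : T → ℕ}
    (hn : CodeFP eT unE nf) (hs : CodeFP eT unE sf) (hlab : CodeFP eT (rawE intE) labf)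
    (hval : CodeFP eT tabE valf) (hj : CodeFP eT natE jf) (hi : CodeFP eT natE i'f) :
    CodeFP eT intE (fun t => outVal (nf t) (sf t) (labf t) (valf t) (jf t) (i'f t)) := by
  have hnN := natOfUn' hn
  have hsN := natOfUn' hs
  -- `base t = sn + s²`, `stride t = (n+s) j`
  have hbase : CodeFP eT natE (fun t => sf t * nf t + sf t * sf t) :=
    (natAdd.comp ((natMul.comp (hsN.pair hnN)).pair (natMul.comp (hsN.pair hsN))) :)
  have hstride : CodeFP eT natE (fun t => (nf t + sf t) * jf t) :=
    (natMul.comp ((natAdd.comp (hnN.pair hsN)).pair hj) :)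
  have hhead : CodeFP eT intE (fun t =>
      (labf t).getD (sf t * nf t + (sf t * sf t + (i'f t + (nf t + sf t) * jf t))) 0) :=
    ((rawGetOr intE).comp (hlab.pair ((natAdd.comp (hbase.pair (natAdd.comp (hi.pair hstride)))).pair
      (const _ (0 : ℤ))))).congr fun t => by simp only [Nat.add_assoc]
  -- item `q = (t, t')`
  have qlabAt : CodeFP (pairE eT natE) intE (fun q =>
      (labf q.1).getD (sf q.1 * nf q.1 + (sf q.1 * sf q.1 + ((nf q.1 + q.2) + (nf q.1 + sf q.1) * jf q.1))) 0) :=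
    ((rawGetOr intE).comp ((hlab.comp (fst _ _)).pair ((natAdd.comp (((hbase.comp (fst _ _))).pair
      (natAdd.comp ((natAdd.comp ((hnN.comp (fst _ _)).pair (snd _ _))).pair (hstride.comp (fst _ _)))))).pair
      (const _ (0 : ℤ))))).congr fun q => by simp only [Nat.add_assoc]
  have qvalAt : CodeFP (pairE eT natE) intE (fun q => ((valf q.1).getD q.2 []).getD (i'f q.1) 0) :=
    ((rawGetOr intE).comp (((rawGetOr (rawE intE)).comp ((hval.comp (fst _ _)).pair ((snd _ _).pair
      (const _ ([] : List ℤ))))).pair ((hi.comp (fst _ _)).pair (const _ (0 : ℤ)))) :)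
  have qitem : CodeFP (pairE eT natE) intE (fun q =>
      (labf q.1).getD (sf q.1 * nf q.1 + (sf q.1 * sf q.1 + ((nf q.1 + q.2) + (nf q.1 + sf q.1) * jf q.1))) 0 *
        ((valf q.1).getD q.2 []).getD (i'f q.1) 0) := (intMul.comp (qlabAt.pair qvalAt) :)
  have hsum := intSum.comp ((CodeFP.map qitem).comp ((CodeFP.id eT).pair (urange.comp hs)))
  exact (intAdd.comp (hhead.pair hsum)).congr fun _ => rfl

/-- ★ **The numeric twin of `Ũ` on codes**: on any context carrying `1ⁿ`, `1ˢ`, the integer point `z`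
(raw list, code `intE`) and the indices `j`, `i` as `CodeFP` data, `t ↦ uEvalN n s z j i` is computed
on codes by a polynomial-time string function, with values in `intE`. With
`eval_universalMapInt_eq_uEvalN`: **the integer universal map is evaluated exactly in polynomial
time.** [cite: KumarVolk2022, §4.1, §6 (proof of Cor 1.3)] [cite: AroraBarak2009, §1.3] -/
theorem uEvalNFP {zf : T → List ℤ} {jf i'f : T → ℕ} (hn : CodeFP eT unE nf) (hs : CodeFP eT unE sf)
    (hz : CodeFP eT (rawE intE) zf) (hj : CodeFP eT natE jf) (hi : CodeFP eT natE i'f) :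
    CodeFP eT intE (fun t => uEvalN (nf t) (sf t) (zf t) (jf t) (i'f t)) := by
  have hlab := labTableFP hn hs hz
  have hctx : CodeFP eT ctxE (fun t => (nf t, sf t, labTable (nf t) (sf t) (zf t))) := hn.pair (hs.pair hlab)
  have hval : CodeFP eT tabE (fun t =>
      valTable (nf t) (sf t) (labTable (nf t) (sf t) (zf t)) (sf t)) := (valTableFP.comp hctx :)
  exact (outValFP hn hs hlab hval hj hi).congr fun _ => rfl

end Codes


end UEval

end KumarVolk2020

end Literature.Computability.AlgebraicComplexity

end
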